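import Literature.Probability.LatticeModels.GlauberBoundaryGradientCore
import Literature.Probability.LatticeModels.BoxSplitTwoBlockGap
import HarnessLib

/-!
# [Mar99] Lemma 4.8, the recursion step for a box: `k_m(R) ≤ (1 + ε) k_m(R₁)`, PROVED in explicit form

Topic `Literature/Probability/LatticeModels`; cell `ym-ir`, seat lit-3 (census rows B2/B4).  Theorems only
(D-0026).  [Mar99] F. Martinelli, LNM 1717 (1999), Lemma 4.8 and its proof, p0192 L35 – p0195 L1 (held text
`book:bertoin1999-lectures-probability-theory-statistics`): the constant `k_m(R)` of the boundary-gradient bound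
(4.27) `|∇_x √(μ_R^τ(f²))|² ≤ k (μ_R^τ(|∇_x f|²) + Σ_{y∈R} e^{−m|x−y|} μ_R^τ(|∇_y f|²))`, `x ∈ ∂_r^+ R`, of a
rectangle `R` is compared with that of a sub-rectangle `R_i ⊂ R` of half the length containing the part of `R`
near `x` (the three rectangles `R_1, R_2, R_3` of p0193 L9–15, chosen according to the position of `x_2` in
`I_1, I_2, I_3`, (4.31)).  Contents:
* `Glauber.integral_gradWeight_eq` & co. — bookkeeping for the weight `|∇_x f|² + Σ_y e^{−m|x−y|}|∇_y f|²`;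
* `Glauber.sq_sqrt_sub_sqrt_le_of_SMT` — the one-step estimate of the core file
  (`sq_sqrt_sub_sqrt_le_of_subvolume`) with the oscillation `‖h_x − 1‖_∞` SUPPLIED from `SMT` in the sub-volume
  (p0193 L26–30 «our assumption together with proposition 2.12 implies `‖h_x − 1‖_∞ ≤ e^{−CL}`»; here:
  (2.18) = `abs_bavg_sub_bavg_le_sum` and the `SMT` covariance bound, as in the tree's rendering of Prop. 2.12):
  `δ = R³ (2r+1)^{2d} |V| e^{−m(D − 2r)}` when `V ∖ A` is at distance `≥ D` from `x`;
* `Glauber.sq_sqrt_sub_sqrt_le_box_of_subboxes` — for a box `Q = Π[a_i,b_i)` and a direction `j` with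
  `b_j − a_j ≥ 8(D+2)`: IF the three half-length sub-boxes along `j` (bottom / middle / top, (4.31)) satisfy
  `SMT` and the gradient bound with constant `k'`, and `μ_Q^τ` has a Poincaré constant `g₀`, THEN `Q` satisfies
  the gradient bound at EVERY `x ∉ Q` with constant
  `(1+t)(1+Rδ)²(1−Rδ)⁻¹ k' + (1+t⁻¹)(9R²δ²/g₀) · ½ e^{m'(r+M)}` (`M` ≥ the sides; far sites `d(x,Q) > r` by the
  reverse triangle inequality, `h_x ≡ 1`) — (4.36)–(4.37) with `3k̄e^{−CL} μ(|∇_R f|²) ≤ e^{−(C/2)L} Σ_y e^{−m|x−y|}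
  μ(|∇_y f|²)` (p0194 L22–26) made explicit through `M`.
The scale bookkeeping (fat rectangles, the choice `D ≈ L/8`, `t = t(L)`, iteration, Corollary 4.9) is the
companion file `GlauberBoundaryGradientFatRectangles`.  SIBLING-SETTING material (`±1` spins, finite range);
nothing here concerns gauge theories or the Yang–Mills gap.
[cite: Martinelli1999, Lemma 4.8, proof, (4.31)–(4.37)]
-/

open MeasureTheory ProbabilityTheory Finset Filter

noncomputable section

namespace Literature.Probability.LatticeModels

namespace Glauber

variable {d : ℕ}

/-! ### The weight `|∇_x f|² + Σ_y e_y |∇_y f|²` -/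

section Weight

/-- The weight observable of (4.27) is measurable. [cite: Martinelli1999, Lemma 4.8, (4.27)] -/
theorem measurable_gradWeight (x : Site d) (A : Finset (Site d)) (e : Site d → ℝ) {f : (Site d → ℤˣ) → ℝ}
    (hf : Measurable f) :
    Measurable (fun σ => siteGrad x f σ ^ 2 + ∑ y ∈ A, e y * siteGrad y f σ ^ 2) :=
  ((measurable_siteGrad x hf).pow_const 2).add
    (Finset.measurable_sum _ fun y _ => ((measurable_siteGrad y hf).pow_const 2).const_mul _)

/-- The weight observable is nonnegative for nonnegative weights. [cite: Martinelli1999, Lemma 4.8, (4.27)] -/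
theorem gradWeight_nonneg (x : Site d) (A : Finset (Site d)) {e : Site d → ℝ} (he : ∀ y, 0 ≤ e y)
    (f : (Site d → ℤˣ) → ℝ) (σ : Site d → ℤˣ) : 0 ≤ siteGrad x f σ ^ 2 + ∑ y ∈ A, e y * siteGrad y f σ ^ 2 :=
  add_nonneg (sq_nonneg _) (sum_nonneg fun y _ => mul_nonneg (he y) (sq_nonneg _))

/-- A squared gradient of a function bounded by `C` is at most `(2C)²`. [cite: Martinelli1999, §2.1] -/
theorem siteGrad_sq_le {f : (Site d → ℤˣ) → ℝ} {C : ℝ} (hC : ∀ σ, |f σ| ≤ C) (y : Site d) (σ : Site d → ℤˣ) :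
    siteGrad y f σ ^ 2 ≤ (C + C) ^ 2 := by
  rw [← sq_abs]
  refine pow_le_pow_left₀ (abs_nonneg _) ?_ 2
  unfold siteGrad
  exact (abs_sub _ _).trans (add_le_add (hC _) (hC _))

/-- The weight observable is bounded by `(1 + |A|)(2C)²` for weights in `[0,1]`.
[cite: Martinelli1999, Lemma 4.8, (4.27)] -/
theorem abs_gradWeight_le (x : Site d) (A : Finset (Site d)) {e : Site d → ℝ} (he0 : ∀ y, 0 ≤ e y)
    (he1 : ∀ y, e y ≤ 1) {f : (Site d → ℤˣ) → ℝ} {C : ℝ} (hC : ∀ σ, |f σ| ≤ C) (σ : Site d → ℤˣ) :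
    |siteGrad x f σ ^ 2 + ∑ y ∈ A, e y * siteGrad y f σ ^ 2| ≤ (1 + A.card) * (C + C) ^ 2 := by
  rw [abs_of_nonneg (gradWeight_nonneg x A he0 f σ)]
  calc siteGrad x f σ ^ 2 + ∑ y ∈ A, e y * siteGrad y f σ ^ 2
      ≤ (C + C) ^ 2 + ∑ _y ∈ A, 1 * (C + C) ^ 2 :=
        add_le_add (siteGrad_sq_le hC x σ)
          (sum_le_sum fun y _ => mul_le_mul (he1 y) (siteGrad_sq_le hC y σ) (sq_nonneg _) zero_le_one)
    _ = (1 + A.card) * (C + C) ^ 2 := by rw [sum_const, nsmul_eq_mul]; ring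

/-- Integrating the weight: `ν(|∇_x f|² + Σ_y e_y |∇_y f|²) = ν(|∇_x f|²) + Σ_y e_y ν(|∇_y f|²)`.
[cite: Martinelli1999, Lemma 4.8, (4.27)] -/
theorem integral_gradWeight_eq (ν : Measure (Site d → ℤˣ)) [IsFiniteMeasure ν] (x : Site d) (A : Finset (Site d))
    (e : Site d → ℝ) {f : (Site d → ℤˣ) → ℝ} (hf : Measurable f) {C : ℝ} (hC : ∀ σ, |f σ| ≤ C) :
    ∫ σ, (siteGrad x f σ ^ 2 + ∑ y ∈ A, e y * siteGrad y f σ ^ 2) ∂ν =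
      ∫ σ, siteGrad x f σ ^ 2 ∂ν + ∑ y ∈ A, e y * ∫ σ, siteGrad y f σ ^ 2 ∂ν := by
  have hi : ∀ y, Integrable (fun σ => siteGrad y f σ ^ 2) ν := fun y =>
    Integrable.of_bound ((measurable_siteGrad y hf).pow_const 2).aestronglyMeasurable ((C + C) ^ 2)
      (Eventually.of_forall fun σ => by
        rw [Real.norm_eq_abs, abs_of_nonneg (sq_nonneg _)]; exact siteGrad_sq_le hC y σ)
  have hi' : ∀ y ∈ A, Integrable (fun σ => e y * siteGrad y f σ ^ 2) ν := fun y _ => (hi y).const_mul _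
  rw [integral_add (hi x) (integrable_finsetSum _ hi'), integral_finsetSum _ hi']
  congr 1
  exact sum_congr rfl fun y _ => integral_const_mul _ _

end Weight

/-! ### Sup-distance helpers -/

section Geometry

/-- Triangle inequality for the sup-distance (local copy). [folklore] -/
private theorem supDist_triangle₃ (x y z : Site d) : supDist x z ≤ supDist x y + supDist y z := by
  rw [supDist_le_iff]
  intro i
  have e1 := natAbs_sub_le_supDist x y i
  have e2 := natAbs_sub_le_supDist y z i
  have : x i - z i = (x i - y i) + (y i - z i) := by ring
  rw [this]
  exact (Int.natAbs_add_le _ _).trans (Nat.add_le_add e1 e2)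

/-- Two points of a box with sides `≤ M` are at sup-distance `≤ M`. [cite: Martinelli1999, §4.2] -/
theorem supDist_le_of_mem_IcoBox {a b : Site d} {M : ℕ} (hM : ∀ i, b i - a i ≤ M) {y z : Site d}
    (hy : y ∈ (Fintype.piFinset fun i => Finset.Ico (a i) (b i)))
    (hz : z ∈ (Fintype.piFinset fun i => Finset.Ico (a i) (b i))) : supDist y z ≤ M := by
  rw [supDist_le_iff]
  intro i
  have h1 := mem_IcoBox.1 hy i
  have h2 := mem_IcoBox.1 hz i
  have h3 := hM i
  omega

/-- A middle slab `{s ≤ y_j < t}` of a box is a sub-box. [cite: Martinelli1999, Lemma 4.8, proof, p0193 L9–15] -/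
theorem IcoBox_mid_subset (a b : Site d) (j : Fin d) {s t : ℤ} (hs : a j ≤ s) (ht : t ≤ b j) :
    (Fintype.piFinset fun i => Finset.Ico ((Function.update a j s) i) ((Function.update b j t) i)) ⊆
      (Fintype.piFinset fun i => Finset.Ico (a i) (b i)) := by
  intro y hy
  rw [mem_IcoBox] at hy ⊢
  intro i
  obtain ⟨h1, h2⟩ := hy i
  by_cases hij : i = j
  · subst hij; rw [Function.update_self] at h1 h2; exact ⟨hs.trans h1, h2.trans_le ht⟩
  · rw [Function.update_of_ne hij] at h1 h2; exact ⟨h1, h2⟩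

end Geometry

/-! ### The one-step estimate with the oscillation supplied from `SMT` in the sub-volume -/

section Step

variable {r : ℕ} (U : FRPotential d ℤˣ r) (β : ℝ)

set_option maxHeartbeats 1600000 in
/-- **[Mar99] Lemma 4.8, one step, with `‖h_x − 1‖_∞` from `SMT(A)`** (p0193 L26–30 and (4.36)–(4.37)):
`A ⊆ V` finite, `x ∉ V`, every site of `V ∖ A` at sup-distance `≥ D > r` from `x` with `l + 2r ≤ D`,
`SMT(A, l, m)`, a Poincaré constant `g₀` for `μ_V^τ`, and the gradient bound (4.27) of `A` at `x` with constants
`(k', m')`.  Then with `δ ≥ R³ (2r+1)^{2d} |V| e^{−m(D−2r)}` and `ρ² ≥ 1`, `ρ² ≥ R²` or (`Rδ < 1`, `ρ² ≥ (1−Rδ)⁻¹`),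
for every `t > 0`: `|∇_x √(μ_V^·(f²))|²(τ) ≤ (1+t)(1+Rδ)²ρ²k' (μ_V^τ(|∇_x f|²) + Σ_{y∈A} e^{−m'|x−y|} μ_V^τ(|∇_y f|²))
+ (1+t⁻¹)(9R²δ²/g₀) 𝓔_V^τ(f,f)`. [cite: Martinelli1999, Lemma 4.8, proof, (4.32)–(4.37)] -/
theorem sq_sqrt_sub_sqrt_le_of_SMT {Rb : ℝ} (hR1 : 1 ≤ Rb)
    (hR : ∀ (Λ : Finset (Site d)) (y : Site d) (σ : Site d → ℤˣ),
      Rb⁻¹ ≤ flipWeight U β Λ y σ ∧ flipWeight U β Λ y σ ≤ Rb)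
    {V A : Finset (Site d)} (hAV : A ⊆ V) {x : Site d} (hxV : x ∉ V) (τ : Site d → ℤˣ)
    {g₀ : ℝ} (hg₀ : 0 < g₀) (hPI : PoincareIneq (U.spec β V τ) V g₀)
    {lS : ℕ} {m : ℝ} (hm : 0 ≤ m) (hSMT : SMT (U.spec β) A lS m)
    {D : ℕ} (hlD : lS + 2 * r ≤ D) (hrD : r < D) (hfar : ∀ z ∈ V, z ∉ A → D ≤ supDist x z)
    {δ : ℝ} (hδ : Rb ^ 3 * (2 * r + 1 : ℝ) ^ d * (2 * r + 1 : ℝ) ^ d * V.card *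
      Real.exp (-(m * ((D : ℝ) - 2 * r))) ≤ δ)
    {ρ2 : ℝ} (hρ1 : 1 ≤ ρ2) (hρ : Rb ^ 2 ≤ ρ2 ∨ (Rb * δ < 1 ∧ (1 - Rb * δ)⁻¹ ≤ ρ2))
    {f : (Site d → ℤˣ) → ℝ} (hf : Measurable f) {C : ℝ} (hC : ∀ σ, |f σ| ≤ C)
    {k' m' : ℝ} (hk' : 0 ≤ k') (hm' : 0 ≤ m')
    (hA : ∀ σ : Site d → ℤˣ,
      (Real.sqrt (∫ ω, f ω ^ 2 ∂(U.spec β A (spinFlip x σ))) - Real.sqrt (∫ ω, f ω ^ 2 ∂(U.spec β A σ))) ^ 2 ≤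
        k' * (∫ ω, siteGrad x f ω ^ 2 ∂(U.spec β A σ) +
          ∑ y ∈ A, Real.exp (-(m' * (supDist x y : ℝ))) * ∫ ω, siteGrad y f ω ^ 2 ∂(U.spec β A σ)))
    {t : ℝ} (ht : 0 < t) :
    (Real.sqrt (∫ ω, f ω ^ 2 ∂(U.spec β V (spinFlip x τ))) - Real.sqrt (∫ ω, f ω ^ 2 ∂(U.spec β V τ))) ^ 2 ≤
      (1 + t) * ((1 + Rb * δ) ^ 2 * ρ2 * k') *
          (∫ ω, siteGrad x f ω ^ 2 ∂(U.spec β V τ) +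
            ∑ y ∈ A, Real.exp (-(m' * (supDist x y : ℝ))) * ∫ ω, siteGrad y f ω ^ 2 ∂(U.spec β V τ)) +
        (1 + t⁻¹) * (9 * Rb ^ 2 * δ ^ 2 / g₀) * dirichletForm (U.spec β V τ) V f := by
  classical
  have hγ := U.isSpecification_spec β
  have hR0 : 0 < Rb := by linarith
  have hvB : ∀ (Λ : Finset (Site d)) (y : Site d) (σ : Site d → ℤˣ), |flipWeight U β Λ y σ| ≤ Rb :=
    fun Λ y σ => by rw [abs_of_pos (flipWeight_pos U β Λ y σ)]; exact (hR Λ y σ).2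
  -- the covariance input from `SMT(A)`
  set cst : ℝ := (2 * r + 1 : ℝ) ^ d * (2 * r + 1 : ℝ) ^ d * Rb * Rb * Real.exp (-(m * ((D : ℝ) - 2 * r)))
    with hcst
  have hc : ∀ z ∈ (rOuterBoundary r A).filter (· ∈ V), ∀ ζ : Site d → ℤˣ,
      |∫ ω, flipWeight U β V x ω * flipWeight U β A z ω ∂(U.spec β A ζ) -
        (∫ ω, flipWeight U β V x ω ∂(U.spec β A ζ)) * ∫ ω, flipWeight U β A z ω ∂(U.spec β A ζ)| ≤ cst := by
    intro z hz ζ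
    obtain ⟨hzB, hzV⟩ := Finset.mem_filter.1 hz
    have hzA : z ∉ A := (mem_rOuterBoundary.1 hzB).1
    have hDz : D ≤ supDist x z := hfar z hzV hzA
    have h1 := supDist_le_finsetSupDist_rNeighbourhood_add (r := r) x z
    have h3 : D ≤ finsetSupDist (rNeighbourhood r x) (rNeighbourhood r z) + 2 * r := by omega
    have h4 : (D : ℝ) ≤ (finsetSupDist (rNeighbourhood r x) (rNeighbourhood r z) : ℝ) + 2 * r := by
      exact_mod_cast h3
    have hdist : (lS : ℝ) ≤ (finsetSupDist (rNeighbourhood r x) (rNeighbourhood r z) : ℝ) := by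
      have h5 : lS ≤ finsetSupDist (rNeighbourhood r x) (rNeighbourhood r z) := by omega
      exact_mod_cast h5
    refine (hSMT (flipWeight U β V x) (flipWeight U β A z) (rNeighbourhood r x) (rNeighbourhood r z) Rb Rb
      (measurable_flipWeight U β V x) (measurable_flipWeight U β A z) (dependsOn_flipWeight U β V x)
      (dependsOn_flipWeight U β A z) (hvB V x) (hvB A z) hdist ζ).trans ?_
    rw [card_rNeighbourhood, card_rNeighbourhood, hcst]
    push_cast
    have h5 : (D : ℝ) - 2 * r ≤ (finsetSupDist (rNeighbourhood r x) (rNeighbourhood r z) : ℝ) := by linarith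
    have hexp' : Real.exp (-(m * (finsetSupDist (rNeighbourhood r x) (rNeighbourhood r z) : ℝ))) ≤
        Real.exp (-(m * ((D : ℝ) - 2 * r))) :=
      Real.exp_le_exp.2 (neg_le_neg (mul_le_mul_of_nonneg_left h5 hm))
    gcongr
  have hT : ∀ z ∈ (↑(rNeighbourhood r x) : Set (Site d)), z ∈ V → z ∈ A := by
    intro z hz hzV
    by_contra hzA
    have h1 := hfar z hzV hzA
    have h2 : supDist z x ≤ r := mem_rNeighbourhood.1 (Finset.mem_coe.1 hz)
    rw [supDist_comm] at h2
    omega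
  -- total oscillation `≤ δ`
  have hcard : (((rOuterBoundary r A).filter (· ∈ V)).card : ℝ) ≤ V.card := by
    exact_mod_cast Finset.card_le_card fun z hz => (Finset.mem_filter.1 hz).2
  have hsum_le : Rb * ∑ _z ∈ (rOuterBoundary r A).filter (· ∈ V), cst ≤ δ := by
    rw [Finset.sum_const, nsmul_eq_mul]
    refine le_trans ?_ hδ
    rw [hcst]
    have : Rb * ((((rOuterBoundary r A).filter (· ∈ V)).card : ℝ) *
        ((2 * r + 1 : ℝ) ^ d * (2 * r + 1 : ℝ) ^ d * Rb * Rb * Real.exp (-(m * ((D : ℝ) - 2 * r))))) ≤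
        Rb * ((V.card : ℝ) *
        ((2 * r + 1 : ℝ) ^ d * (2 * r + 1 : ℝ) ^ d * Rb * Rb * Real.exp (-(m * ((D : ℝ) - 2 * r))))) := by
      gcongr
    exact this.trans (le_of_eq (by ring))
  have hδ0 : 0 ≤ δ := le_trans (by positivity) hsum_le
  have hosc : ∀ σ σ' : Site d → ℤˣ, (∀ z ∉ V, σ z = σ' z) →
      |bavg (U.spec β) A (flipWeight U β V x) σ - bavg (U.spec β) A (flipWeight U β V x) σ'| ≤ δ :=
    fun σ σ' hag => (abs_bavg_sub_bavg_le_sum U β hR1 hR (W := V) (A := A) (measurable_flipWeight U β V x)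
      (dependsOn_flipWeight U β V x) hT hc σ σ' hag).trans hsum_le
  -- the weight
  set e : Site d → ℝ := fun y => Real.exp (-(m' * (supDist x y : ℝ))) with he
  have he0 : ∀ y, 0 ≤ e y := fun y => Real.exp_nonneg _
  have he1 : ∀ y, e y ≤ 1 := fun y => by
    rw [he]
    exact Real.exp_le_one_iff.2 (neg_nonpos.2 (mul_nonneg hm' (Nat.cast_nonneg _)))
  set w : (Site d → ℤˣ) → ℝ := fun σ => siteGrad x f σ ^ 2 + ∑ y ∈ A, e y * siteGrad y f σ ^ 2 with hw
  have hwm : Measurable w := measurable_gradWeight x A e hf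
  have hw0 : ∀ σ, 0 ≤ w σ := fun σ => gradWeight_nonneg x A he0 f σ
  have hwb : ∀ σ, |w σ| ≤ (1 + A.card) * (C + C) ^ 2 := fun σ => abs_gradWeight_le x A he0 he1 hC σ
  -- the inductive hypothesis in `bavg`-form
  have hA' : ∀ σ : Site d → ℤˣ,
      (Real.sqrt (bavg (U.spec β) A (fun ω => f ω ^ 2) (spinFlip x σ)) -
          Real.sqrt (bavg (U.spec β) A (fun ω => f ω ^ 2) σ)) ^ 2 ≤ k' * bavg (U.spec β) A w σ := by
    intro σ
    haveI := hγ.isProbability A σ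
    have e1 : bavg (U.spec β) A w σ = ∫ ω, siteGrad x f ω ^ 2 ∂(U.spec β A σ) +
        ∑ y ∈ A, e y * ∫ ω, siteGrad y f ω ^ 2 ∂(U.spec β A σ) :=
      integral_gradWeight_eq (U.spec β A σ) x A e hf hC
    rw [e1]
    exact hA σ
  have key := sq_sqrt_sub_sqrt_le_of_subvolume U β hR1 hR hAV hxV τ hg₀ hPI hδ0 hosc hρ1 hρ hf hC hwm hwb hw0
    hk' hA' ht
  haveI := hγ.isProbability V τ
  rw [integral_gradWeight_eq (U.spec β V τ) x A e hf hC] at key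
  exact key

set_option maxHeartbeats 1600000 in
/-- **[Mar99] Lemma 4.8, the recursion step for a box** ((4.31)–(4.37) with the three sub-rectangles
`R_1, R_2, R_3` of p0193 L9–15): let `Q = Π[a_i,b_i)`, `j` a direction with `ℓ = b_j − a_j ≥ 8(D+2)`,
`l + 2r ≤ D`, `r < D`; assume a Poincaré constant `g₀` for all `μ_Q^τ`, and that each sub-box
`{s ≤ y_j < s + ⌈ℓ/2⌉}` of `Q` satisfies `SMT(·, l, m)` and the gradient bound (4.27) with constants `(k', m')`
(`k' ≥ 1`) at every outside site.  Then `Q` satisfies (4.27) at every `x ∉ Q`, with constant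
`(1+t)(1+Rδ)²(1−Rδ)⁻¹ k' + (1+t⁻¹)(9R²δ²/g₀) ½ e^{m'(r+M)}`, where `δ ≥ R³(2r+1)^{2d}|Q|e^{−m(D−2r)}`, `Rδ ≤ ½`,
and `M` bounds the sides of `Q` (so that `𝓔_Q^τ(f,f) ≤ ½ e^{m'(r+M)} Σ_y e^{−m'|x−y|} μ_Q^τ(|∇_y f|²)` for
`x ∈ ∂_r^+Q`, p0194 L22–26; sites with `d(x,Q) > r` are handled by `h_x ≡ 1`).
[cite: Martinelli1999, Lemma 4.8, proof, (4.31)–(4.37)] -/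
theorem sq_sqrt_sub_sqrt_le_box_of_subboxes {Rb : ℝ} (hR1 : 1 ≤ Rb)
    (hR : ∀ (Λ : Finset (Site d)) (y : Site d) (σ : Site d → ℤˣ),
      Rb⁻¹ ≤ flipWeight U β Λ y σ ∧ flipWeight U β Λ y σ ≤ Rb)
    {a b : Site d} {j : Fin d} {lS : ℕ} {m : ℝ} (hm : 0 ≤ m) {k' m' g₀ : ℝ} (hk' : 1 ≤ k') (hm' : 0 ≤ m')
    (hg₀ : 0 < g₀)
    (hPI : ∀ τ : Site d → ℤˣ, PoincareIneq (U.spec β (Fintype.piFinset fun i => Finset.Ico (a i) (b i)) τ)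
      (Fintype.piFinset fun i => Finset.Ico (a i) (b i)) g₀)
    (hsub : ∀ s : ℤ, a j ≤ s → s + (b j - a j - (b j - a j) / 2) ≤ b j →
      SMT (U.spec β) (Fintype.piFinset fun i => Finset.Ico ((Function.update a j s) i)
        ((Function.update b j (s + (b j - a j - (b j - a j) / 2))) i)) lS m ∧
      ∀ (σ : Site d → ℤˣ) (x : Site d),
        x ∉ (Fintype.piFinset fun i => Finset.Ico ((Function.update a j s) i)
          ((Function.update b j (s + (b j - a j - (b j - a j) / 2))) i)) →
        ∀ f : (Site d → ℤˣ) → ℝ, Measurable f → ∀ C : ℝ, (∀ σ, |f σ| ≤ C) →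
          (Real.sqrt (∫ ω, f ω ^ 2 ∂(U.spec β (Fintype.piFinset fun i => Finset.Ico ((Function.update a j s) i)
              ((Function.update b j (s + (b j - a j - (b j - a j) / 2))) i)) (spinFlip x σ))) -
            Real.sqrt (∫ ω, f ω ^ 2 ∂(U.spec β (Fintype.piFinset fun i => Finset.Ico ((Function.update a j s) i)
              ((Function.update b j (s + (b j - a j - (b j - a j) / 2))) i)) σ))) ^ 2 ≤
          k' * (∫ ω, siteGrad x f ω ^ 2 ∂(U.spec β (Fintype.piFinset fun i => Finset.Ico
              ((Function.update a j s) i) ((Function.update b j (s + (b j - a j - (b j - a j) / 2))) i)) σ) +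
            ∑ y ∈ (Fintype.piFinset fun i => Finset.Ico ((Function.update a j s) i)
              ((Function.update b j (s + (b j - a j - (b j - a j) / 2))) i)),
              Real.exp (-(m' * (supDist x y : ℝ))) * ∫ ω, siteGrad y f ω ^ 2 ∂(U.spec β (Fintype.piFinset
                fun i => Finset.Ico ((Function.update a j s) i)
                  ((Function.update b j (s + (b j - a j - (b j - a j) / 2))) i)) σ)))
    {D : ℕ} (hD : 8 * ((D : ℤ) + 2) ≤ b j - a j) (hlD : lS + 2 * r ≤ D) (hrD : r < D)
    {δ : ℝ} (hδ : Rb ^ 3 * (2 * r + 1 : ℝ) ^ d * (2 * r + 1 : ℝ) ^ d *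
      ((Fintype.piFinset fun i => Finset.Ico (a i) (b i)).card : ℝ) * Real.exp (-(m * ((D : ℝ) - 2 * r))) ≤ δ)
    (hδs : Rb * δ ≤ 1 / 2) {M : ℕ} (hM : ∀ i, b i - a i ≤ M) {t : ℝ} (ht : 0 < t)
    (τ : Site d → ℤˣ) {x : Site d} (hx : x ∉ (Fintype.piFinset fun i => Finset.Ico (a i) (b i)))
    {f : (Site d → ℤˣ) → ℝ} (hf : Measurable f) {C : ℝ} (hC : ∀ σ, |f σ| ≤ C) :
    (Real.sqrt (∫ ω, f ω ^ 2 ∂(U.spec β (Fintype.piFinset fun i => Finset.Ico (a i) (b i)) (spinFlip x τ))) -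
        Real.sqrt (∫ ω, f ω ^ 2 ∂(U.spec β (Fintype.piFinset fun i => Finset.Ico (a i) (b i)) τ))) ^ 2 ≤
      ((1 + t) * ((1 + Rb * δ) ^ 2 * (1 - Rb * δ)⁻¹ * k') +
          (1 + t⁻¹) * (9 * Rb ^ 2 * δ ^ 2 / g₀) * ((1 / 2) * Real.exp (m' * (r + M)))) *
        (∫ ω, siteGrad x f ω ^ 2 ∂(U.spec β (Fintype.piFinset fun i => Finset.Ico (a i) (b i)) τ) +
          ∑ y ∈ (Fintype.piFinset fun i => Finset.Ico (a i) (b i)), Real.exp (-(m' * (supDist x y : ℝ))) *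
            ∫ ω, siteGrad y f ω ^ 2 ∂(U.spec β (Fintype.piFinset fun i => Finset.Ico (a i) (b i)) τ)) := by
  classical
  have hγ := U.isSpecification_spec β
  set Q := (Fintype.piFinset fun i => Finset.Ico (a i) (b i)) with hQ
  haveI := hγ.isProbability Q τ
  set ℓ := b j - a j with hℓ
  set hh := b j - a j - (b j - a j) / 2 with hhh
  have hR0 : 0 < Rb := by linarith
  have hδ0 : 0 ≤ δ := le_trans (by positivity) hδ
  have hRδ : Rb * δ < 1 := by linarith
  set e : Site d → ℝ := fun y => Real.exp (-(m' * (supDist x y : ℝ))) with he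
  have he0 : ∀ y, 0 ≤ e y := fun y => Real.exp_nonneg _
  have hDy0 : ∀ y, 0 ≤ ∫ ω, siteGrad y f ω ^ 2 ∂(U.spec β Q τ) := fun y => integral_nonneg fun _ => sq_nonneg _
  set Dx := ∫ ω, siteGrad x f ω ^ 2 ∂(U.spec β Q τ) with hDx
  set SQ := ∑ y ∈ Q, e y * ∫ ω, siteGrad y f ω ^ 2 ∂(U.spec β Q τ) with hSQ
  have hDx0 : 0 ≤ Dx := hDy0 x
  have hSQ0 : 0 ≤ SQ := sum_nonneg fun y _ => mul_nonneg (he0 y) (hDy0 y)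
  set α := (1 + t) * ((1 + Rb * δ) ^ 2 * (1 - Rb * δ)⁻¹ * k') with hα
  set γ' := (1 + t⁻¹) * (9 * Rb ^ 2 * δ ^ 2 / g₀) * ((1 / 2) * Real.exp (m' * (r + M))) with hγ'
  have h1Rδ : 1 ≤ (1 - Rb * δ)⁻¹ := by
    rw [le_inv_comm₀ one_pos (by linarith), inv_one]; nlinarith
  have hα1 : 1 ≤ α := by
    rw [hα]
    have h1 : (1 : ℝ) ≤ 1 + t := by linarith
    have h2 : (1 : ℝ) ≤ (1 + Rb * δ) ^ 2 := by nlinarith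
    calc (1 : ℝ) = 1 * (1 * 1 * 1) := by ring
      _ ≤ (1 + t) * ((1 + Rb * δ) ^ 2 * (1 - Rb * δ)⁻¹ * k') := by
          gcongr
  have hα0 : 0 ≤ α := zero_le_one.trans hα1
  have hγ'0 : 0 ≤ γ' := by positivity
  show _ ≤ (α + γ') * (Dx + SQ)
  by_cases hnear : ∃ z ∈ Q, supDist x z ≤ r
  swap
  · -- far sites: `h_x ≡ 1`
    push Not at hnear
    have h1 := sq_sqrt_sub_sqrt_le_of_forall_lt U β hnear τ hf hC
    calc _ ≤ Dx := h1
      _ ≤ (α + γ') * (Dx + SQ) := by nlinarith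
  obtain ⟨z, hzQ, hxz⟩ := hnear
  -- the sub-box adapted to `x_j` ((4.31): bottom / top / middle)
  obtain ⟨s, hs_lo, hs_hi, hs_far⟩ : ∃ s : ℤ, a j ≤ s ∧ s + hh ≤ b j ∧
      ∀ y : Site d, y ∈ Q → (y j < s ∨ s + hh ≤ y j) → (D : ℤ) ≤ x j - y j ∨ (D : ℤ) ≤ y j - x j := by
    by_cases h1 : x j < a j + 3 * ℓ / 8
    · refine ⟨a j, le_rfl, by omega, fun y hy hyc => ?_⟩
      have := mem_IcoBox.1 hy j
      rcases hyc with hlt | hge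
      · omega
      · right; omega
    · by_cases h2 : b j - 3 * ℓ / 8 ≤ x j
      · refine ⟨b j - hh, by omega, by omega, fun y hy hyc => ?_⟩
        have := mem_IcoBox.1 hy j
        rcases hyc with hlt | hge
        · left; omega
        · omega
      · refine ⟨a j + ℓ / 4, by omega, by omega, fun y hy hyc => ?_⟩
        have := mem_IcoBox.1 hy j
        rcases hyc with hlt | hge
        · left; omega
        · right; omega
  set A := (Fintype.piFinset fun i => Finset.Ico ((Function.update a j s) i)
    ((Function.update b j (s + hh)) i)) with hA
  have hAQ : A ⊆ Q := IcoBox_mid_subset a b j hs_lo hs_hi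
  obtain ⟨hSMTA, hGBA⟩ := hsub s hs_lo hs_hi
  have hxA : x ∉ A := fun h' => hx (hAQ h')
  have hfar : ∀ y ∈ Q, y ∉ A → D ≤ supDist x y := by
    intro y hyQ hyA
    have hyc : y j < s ∨ s + hh ≤ y j := by
      by_contra hcon
      push Not at hcon
      apply hyA
      rw [mem_IcoBox]
      intro i
      by_cases hij : i = j
      · subst hij; rw [Function.update_self, Function.update_self]; exact ⟨hcon.1, hcon.2⟩
      · rw [Function.update_of_ne hij, Function.update_of_ne hij]; exact mem_IcoBox.1 hyQ i
    have h1 := hs_far y hyQ hyc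
    have h2 := natAbs_sub_le_supDist x y j
    have h3 : ((x j - y j).natAbs : ℤ) = |x j - y j| := Int.natCast_natAbs _
    have h4 : (D : ℤ) ≤ |x j - y j| := by
      rcases h1 with h | h
      · exact h.trans (le_abs_self _)
      · exact h.trans ((neg_sub (x j) (y j)).symm.le.trans (neg_le_abs _))
    omega
  -- the one-step estimate with `ρ² = (1 − Rδ)⁻¹`
  have key := sq_sqrt_sub_sqrt_le_of_SMT U β hR1 hR hAQ hx τ hg₀ (hPI τ) hm hSMTA hlD hrD hfar hδ h1Rδ
    (Or.inr ⟨hRδ, le_rfl⟩) hf hC (zero_le_one.trans hk') hm' (fun σ => hGBA σ x hxA f hf C hC) ht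
  -- `Σ_{y∈A} ≤ Σ_{y∈Q}` and `𝓔 ≤ ½ e^{m'(r+M)} Σ_{y∈Q} e_y D_y`
  have hsumA : ∑ y ∈ A, e y * ∫ ω, siteGrad y f ω ^ 2 ∂(U.spec β Q τ) ≤ SQ :=
    Finset.sum_le_sum_of_subset_of_nonneg hAQ fun y _ _ => mul_nonneg (he0 y) (hDy0 y)
  have hi : ∀ y, Integrable (fun σ => siteGrad y f σ ^ 2) (U.spec β Q τ) := fun y =>
    Integrable.of_bound ((measurable_siteGrad y hf).pow_const 2).aestronglyMeasurable ((C + C) ^ 2)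
      (Eventually.of_forall fun σ => by
        rw [Real.norm_eq_abs, abs_of_nonneg (sq_nonneg _)]; exact siteGrad_sq_le hC y σ)
  have hE : dirichletForm (U.spec β Q τ) Q f ≤ (1 / 2) * Real.exp (m' * (r + M)) * SQ := by
    unfold dirichletForm
    have e1 : ∫ ω, gradSq Q f ω ∂(U.spec β Q τ) = ∑ y ∈ Q, ∫ ω, siteGrad y f ω ^ 2 ∂(U.spec β Q τ) := by
      unfold gradSq
      exact integral_finsetSum _ fun y _ => hi y
    rw [e1, mul_assoc]
    refine mul_le_mul_of_nonneg_left ?_ (by norm_num)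
    rw [hSQ, Finset.mul_sum]
    refine Finset.sum_le_sum fun y hy => ?_
    have hd : (supDist x y : ℝ) ≤ r + M := by
      have h1 := supDist_triangle₃ x z y
      have h2 : supDist z y ≤ M := supDist_le_of_mem_IcoBox hM hzQ hy
      have h3 : supDist x y ≤ r + M := h1.trans (add_le_add hxz h2)
      exact_mod_cast h3
    have h3 : 1 ≤ Real.exp (m' * (r + M)) * e y := by
      rw [he, ← Real.exp_add]
      exact Real.one_le_exp (by nlinarith)
    calc ∫ ω, siteGrad y f ω ^ 2 ∂(U.spec β Q τ) = 1 * ∫ ω, siteGrad y f ω ^ 2 ∂(U.spec β Q τ) := (one_mul _).symm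
      _ ≤ (Real.exp (m' * (r + M)) * e y) * ∫ ω, siteGrad y f ω ^ 2 ∂(U.spec β Q τ) :=
          mul_le_mul_of_nonneg_right h3 (hDy0 y)
      _ = Real.exp (m' * (r + M)) * (e y * ∫ ω, siteGrad y f ω ^ 2 ∂(U.spec β Q τ)) := mul_assoc _ _ _
  have hE0 : 0 ≤ dirichletForm (U.spec β Q τ) Q f := dirichletForm_nonneg _ _ _
  calc _ ≤ α * (Dx + ∑ y ∈ A, e y * ∫ ω, siteGrad y f ω ^ 2 ∂(U.spec β Q τ)) +
        (1 + t⁻¹) * (9 * Rb ^ 2 * δ ^ 2 / g₀) * dirichletForm (U.spec β Q τ) Q f := key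
    _ ≤ α * (Dx + SQ) + (1 + t⁻¹) * (9 * Rb ^ 2 * δ ^ 2 / g₀) * ((1 / 2) * Real.exp (m' * (r + M)) * SQ) :=
        add_le_add (mul_le_mul_of_nonneg_left (add_le_add le_rfl hsumA) hα0)
          (mul_le_mul_of_nonneg_left hE (by positivity))
    _ = α * (Dx + SQ) + γ' * SQ := by rw [hγ']; ring
    _ ≤ (α + γ') * (Dx + SQ) := by nlinarith

end Step

end Glauber

end Literature.Probability.LatticeModels

end
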